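import Summits.ResolutionOfSingularities.ResolutionOfSingularities.Theses.FrobeniusLadder

/-!
# `FInjectiveMacaulayfication` — negative lemma: Kawasaki's move (blowing up a parameter ideal)
# does not produce — and can destroy — the Frobenius half of the rung

Support (negative) lemma for crux `stmt-ResolutionOfSingularities-15315`
(`Summit.ResolutionOfSingularities.ResolutionOfSingularities.Theses.FrobeniusLadder.FInjectiveMacaulayfication`,
"F-injective Macaulayfication"; standing disprover, cdisprove gen 1, work file
`Cruxes/FInjectiveMacaulayfication/Disproof.lean` §3). This file declares NO definition.

The route transfers Kawasaki's Macaulayfication engine "one rung up"; Kawasaki's centres are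
(products of) ideals generated by parts of systems of parameters, and the route's foreseen split
`IsolatedFInjBlowup` reads "one blow-up of a Frobenius-standard PARAMETER ideal makes an isolated
non-F-injective Cohen–Macaulay point CM and F-injective". The smallest test is the rational double
point `E₈⁰ : z² + x³ + y⁵ = 0` (an isolated normal hypersurface singularity; not F-injective in
characteristic `2, 3, 5`, F-regular for `p ≥ 7`) blown up along the parameter ideal `Q = (x, y)`.
In the chart `y = xT` the blow-up is the integral surface

  `A = k[x, T, z] / (z² + x³ + x⁵T⁵)`,   `z² = -x³ (1 + x²T⁵)`,

singular along the whole curve `C = {x = z = 0}` lying over the vertex (the exceptional divisor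
`{x = 0} = {x = 0, z² = 0}` is non-reduced, and transversally to `C` the surface is a cusp).

* `fInjectiveMacaulayfication_parameterBlowupChart_not_frobeniusClosed` — **for EVERY prime `p`
  and every field `k`, in `A` the parameter ideal `I = (x, T)` of the origin of the chart is not
  Frobenius closed: `z ∉ I` but `z^p ∈ I^[p] = span {w^p | w ∈ I}`** (`p = 2`:
  `z² = x² · (-x(1 + x²T⁵))`; `p = 2j+1 ≥ 3`: `z^p = z (z²)^j = ± z (1 + x²T⁵)^j x^{j-1} · x^p`).
  (`I` is primary to the maximal ideal `(x, T, z)` — `A/I ≅ k[z]/(z²)` — so the same holds in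
  the local ring at the origin, where `(x, T)` is a system of parameters of the two-dimensional
  hypersurface, hence Cohen–Macaulay, domain `A_(x,T,z)`: that local ring satisfies the depth half
  of the crux's clause and violates the Frobenius half.)

CONSEQUENCES for the engine (all characteristics at once):
* for `p ≥ 7` the vertex of `E₈⁰` is F-regular, so **blowing up a parameter ideal can DESTROY
  F-injectivity** (the class "locally integral + CM + F-injective" is not stable under Kawasaki's
  move), and for `p ≤ 5` the move **fails to create it**: either way the transplanted engine needs
  centres that are not parameter ideals (cf. the ideators' Cartier-trace pigeonhole in the crux
  directory, `NOTES-ideator1.md`: a centre with `ν ≤ c + 1` generators never passes);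
* the failure is the "nilpotent wall": the non-reduced exceptional divisor carries a transversal
  cusp, exactly the specimen of `CohenMacaulayNotFInjective.lean` one dimension up.

## Sources
* T. Kawasaki, Trans. AMS 352 (2000), Thm. 1.1 and §4 (centres of the Macaulayfication).
* K. Česnavičius, Duke Math. J. 170 (2021) = arXiv:1810.04493, §1 (the CM rung).
* R. Fedder, Trans. AMS 278 (1983) (Frobenius closure of parameter ideals ⇔ F-injectivity, CM case).
* M. Artin, *Coverings of the rational double points in characteristic p* (1977) — `E₈⁰`
  notation; not used in the proof.
-/

-- single-problem summit: the doubled namespace component `ResolutionOfSingularities` is forced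
set_option linter.dupNamespace false

namespace Summit.ResolutionOfSingularities.ResolutionOfSingularities.Theorems.FInjectiveMacaulayfication.Negative

open MvPolynomial

/-- **The `y = xT` chart of the blow-up of `E₈⁰ : z² + x³ + y⁵` along the parameter ideal
`(x, y)` is nowhere F-injective along the exceptional curve — all characteristics.** In
`A = k[X₀, X₁, X₂]/(X₂² + X₀³ + X₀⁵X₁⁵)` (`x = X₀`, `T = X₁`, `z = X₂`) with `uᵢ` the class of
`Xᵢ` and `I = (u₀, u₁)`: `u₂ ∉ I` (evaluate `X₂ ↦ ε`, `X₀, X₁ ↦ 0` into the dual numbers: the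
relation dies since `ε² = 0`, `I` dies, `u₂ ↦ ε ≠ 0`) and `u₂^p ∈ span {w^p | w ∈ I}` for every
prime `p` (`u₂² = -u₀³(1 + u₀²u₁⁵)`, and `3j ≥ 2j + 1` for `j ≥ 1`). [folklore] -/
theorem fInjectiveMacaulayfication_parameterBlowupChart_not_frobeniusClosed
    (p : ℕ) (hp : p.Prime) (k : Type) [Field k] :
    let f : MvPolynomial (Fin 3) k := X 2 ^ 2 + X 0 ^ 3 + X 0 ^ 5 * X 1 ^ 5
    let A := MvPolynomial (Fin 3) k ⧸ Ideal.span {f}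
    let u : Fin 3 → A := fun i => Ideal.Quotient.mk (Ideal.span {f}) (X i)
    let I : Ideal A := Ideal.span {u 0, u 1}
    u 2 ∉ I ∧ u 2 ^ p ∈ Ideal.span ((fun z : A => z ^ p) '' (I : Set A)) := by
  intro f A u I
  have hf : f = X 2 ^ 2 + X 0 ^ 3 + X 0 ^ 5 * X 1 ^ 5 := rfl
  have hu : ∀ i, u i = Ideal.Quotient.mk (Ideal.span {f}) (X i) := fun _ => rfl
  have hI : I = Ideal.span {u 0, u 1} := rfl
  -- the defining relation of `A`
  have hrel : u 2 ^ 2 + u 0 ^ 3 + u 0 ^ 5 * u 1 ^ 5 = 0 := by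
    have h : Ideal.Quotient.mk (Ideal.span {f}) (X 2 ^ 2 + X 0 ^ 3 + X 0 ^ 5 * X 1 ^ 5) = 0 :=
      Ideal.Quotient.eq_zero_iff_mem.mpr (Ideal.mem_span_singleton_self f)
    simpa only [map_add, map_mul, map_pow, ← hu] using h
  have hsq : u 2 ^ 2 = u 0 ^ 3 * (-(1 + u 0 ^ 2 * u 1 ^ 5)) := by linear_combination hrel
  have h0 : u 0 ∈ I := by rw [hI]; exact Ideal.subset_span (by simp)
  have h0p : ∀ n : ℕ, u 0 ^ n ∈ Ideal.span ((fun z : A => z ^ n) '' (I : Set A)) := fun n =>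
    Ideal.subset_span ⟨u 0, h0, rfl⟩
  refine ⟨?_, ?_⟩
  · -- `u 2 ∉ I`: evaluate into the dual numbers `k[ε]`, `X 2 ↦ ε`, `X 0, X 1 ↦ 0`
    intro h2
    set v : Fin 3 → DualNumber k := Pi.single 2 DualNumber.eps with hv
    have hvf : (MvPolynomial.aeval v).toRingHom f = 0 := by
      rw [hf]
      simp [hv, DualNumber.eps_pow_two]
    have hker : ∀ a ∈ Ideal.span {f}, (MvPolynomial.aeval v).toRingHom a = 0 := by
      intro a ha
      obtain ⟨c, rfl⟩ := Ideal.mem_span_singleton'.mp ha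
      rw [map_mul, hvf, mul_zero]
    obtain ⟨θ, hθ⟩ :
        ∃ θ : MvPolynomial (Fin 3) k ⧸ Ideal.span {f} →+* DualNumber k, ∀ i, θ (u i) = v i :=
      ⟨Ideal.Quotient.lift (Ideal.span {f}) (MvPolynomial.aeval v).toRingHom hker, fun i => by
        rw [hu, Ideal.Quotient.lift_mk]
        exact MvPolynomial.aeval_X v i⟩
    have hIle : I ≤ RingHom.ker θ := by
      rw [hI, Ideal.span_le]
      rintro x (rfl | rfl) <;> simp [RingHom.mem_ker, hθ, hv]
    have h0' : θ (u 2) = 0 := (RingHom.mem_ker).mp (hIle h2)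
    rw [hθ, hv, Pi.single_eq_same] at h0'
    have h1 := congrArg TrivSqZeroExt.snd h0'
    simp at h1
  · -- `u 2 ^ p ∈ I^[p]`: split `p = 2` / `p = 2j + 1` with `j = i + 1`
    rcases hp.eq_two_or_odd' with rfl | ⟨j, rfl⟩
    · have key : u 2 ^ 2 = (-(1 + u 0 ^ 2 * u 1 ^ 5) * u 0) * u 0 ^ 2 := by rw [hsq]; ring
      rw [key]
      exact Ideal.mul_mem_left _ _ (h0p 2)
    · obtain ⟨i, rfl⟩ : ∃ i, j = i + 1 :=
        ⟨j - 1, by have := hp.two_le; omega⟩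
      have key : u 2 ^ (2 * (i + 1) + 1) =
          (u 2 * (-(1 + u 0 ^ 2 * u 1 ^ 5)) ^ (i + 1) * u 0 ^ i) * u 0 ^ (2 * (i + 1) + 1) := by
        have e1 : u 2 ^ (2 * (i + 1) + 1) = u 2 * (u 2 ^ 2) ^ (i + 1) := by ring
        have e2 : (u 0 ^ 3 * (-(1 + u 0 ^ 2 * u 1 ^ 5))) ^ (i + 1) =
            u 0 ^ (3 * (i + 1)) * (-(1 + u 0 ^ 2 * u 1 ^ 5)) ^ (i + 1) := by
          rw [mul_pow, ← pow_mul]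
        have e3 : u 0 ^ (3 * (i + 1)) = u 0 ^ i * u 0 ^ (2 * (i + 1) + 1) := by
          rw [← pow_add]; congr 1; ring
        rw [e1, hsq, e2, e3]
        ring
      rw [key]
      exact Ideal.mul_mem_left _ _ (h0p _)

end Summit.ResolutionOfSingularities.ResolutionOfSingularities.Theorems.FInjectiveMacaulayfication.Negative
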